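import Literature.NumberTheory.NumberFields.RayClassFieldAdicCharacter
import Literature.NumberTheory.GaloisRepresentations.HeckeCharacterAutConj
import HarnessLib

/-!
# The idele of an element of `Gal(K̄/K(𝔪))`: `σ|_{K^ab} = [e, K]` with `e ∈ W_𝔪` (and `e_∞ = 1`), and
# its `v`-component IS the ray adic character `κσ`

For a number field `K`, an ideal `𝔪 ≠ 0` and `σ ∈ Gal(K̄/K(𝔪)) = ker(Γ_K → Gal(K(𝔪)/K))`, the norm
group of the ray class field (`Kˣ·W_𝔪`, Neukirch VI (7.1); tree
`abRestrict_ideleArtinMap_rayClassField_eq_one_iff`) gives an idele `e ∈ W_𝔪` (units at every finite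
place, `≡ 1 (mod 𝔪)`) with `σ|_{K^ab} = [e, K]`; for `K` totally complex one may moreover take
`e_∞ = 1` (`[·, K]` kills `K_∞ˣ = ∏ ℂˣ`). This is Shimura's step "`s = d·e`" (§18.6). Its point for the
`p`-adic theory (de Shalit II.4.13: reading a Grössencharacter `ε̂` on `𝒢 = Gal(K(𝔣p^∞)/K)`): the value
of any `p`-adic avatar at `σ` is the idelic avatar at `e` (`IsPAdicAvatarOf.avatarValueAt_eq`,
`LAdicCharacterGlobalValueProofs.lean`), and the `v`-component of `e` is, for `v ∤ 𝔪`, THE ray adic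
character `κσ = rayAdicCharacter h𝔪 hv hw σ` of `RayClassFieldAdicCharacter.lean` (de Shalit's `κ` of
I.3.3 (9) / II.1.7 up to the reciprocity sign).

* §1 `exists_mem_rayUnitIdeles_of_mem_ker` (`e ∈ W_𝔪`, `[e, K] = σ|_{K^ab}`); with `e_∞ = 1`:
  `exists_mem_rayUnitIdeles_infPart_eq_one_of_mem_ker` (`K` totally complex); converse
  `mem_ker_of_mem_rayUnitIdeles`.
* §2 `isAdicArtinValue_rayComponent` — the `v`-component of such an `e` is a `v`-adic Artin value of
  `σ` at EVERY `v` (no hypothesis on `v`); ★ `rayAdicCharacter_eq_rayComponent`,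
  ★ `adele_snd_eq_rayAdicCharacter` — for `v ∤ 𝔪`, `w_𝔪 = 1`: **`e_v = κσ`**.

Theorems only; no `sorry`.

## References
* [Shimura1998] G. Shimura, *Abelian Varieties with Complex Multiplication…* (1998), §18.6 proof, p. 128.
* [NeukirchANT1999] J. Neukirch, *Algebraic Number Theory* (1999), Ch. VI §7 Thm. (7.1), §6 (6.1).
* [deShalit1987] E. de Shalit, *Iwasawa theory of elliptic curves with complex multiplication* (1987),
  I.3.3 (9) (p. 18), II.1.7 (p. 41), II.4.13 (p. 69).
-/

noncomputable section

open NumberField IsDedekindDomain IsDedekindDomain.HeightOneSpectrum Field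
open scoped nonZeroDivisors Classical

namespace Literature.NumberTheory.NumberFields

open Literature.NumberTheory.GaloisRepresentations

variable {K : Type} [Field K] [NumberField K] {𝔪 : Ideal (𝓞 K)} {v : HeightOneSpectrum (𝓞 K)}

/-! ### §1. `σ ∈ Gal(K̄/K(𝔪))` ⟹ `σ|_{K^ab} = [e, K]`, `e ∈ W_𝔪` -/

/-- **Shimura's `s = d·e`**: every `σ ∈ Gal(K̄/K(𝔪))` is `[e, K]` on `K^ab` for some `e ∈ W_𝔪`
(`[·, K]` is onto `Gal(K^ab/K)`; `σ|_{K(𝔪)} = 1` puts any preimage in the norm group `Kˣ·W_𝔪`; discard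
the principal factor, `[Kˣ, K] = 1`). [cite: Shimura1998, §18.6 proof, p. 128]
[cite: NeukirchANT1999, Ch. VI §7 Thm. (7.1)] -/
theorem exists_mem_rayUnitIdeles_of_mem_ker {σ : absoluteGaloisGroup K}
    (hσ : σ ∈ (absRestrictNormalHom (rayClassField K 𝔪)).ker) :
    ∃ e ∈ rayUnitIdeles K 𝔪, absGaloisAbProj K σ = ideleArtinMap K e := by
  obtain ⟨s, hs⟩ := exists_ideleArtinMap_eq σ
  have h1 : abRestrict (rayClassField K 𝔪) (ideleArtinMap K s) = 1 := by
    rw [hs, abRestrict_absGaloisAbProj]; exact hσ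
  obtain ⟨d, hd, e, he, rfl⟩ :=
    Subgroup.mem_sup.mp ((abRestrict_ideleArtinMap_rayClassField_eq_one_iff s).mp h1)
  refine ⟨e, he, ?_⟩
  rw [← hs, map_mul, ideleArtinMap_eq_one_of_mem_principalIdeles hd, one_mul]

/-- The finite part of an infinite idele is trivial. [folklore] -/
private theorem finitePart_infiniteIdeles' (y : (InfiniteAdeleRing K)ˣ) :
    IdeleAction.finitePart K (infiniteIdeles K y) = 1 :=
  Units.ext rfl

/-- Multiplying by an infinite idele does not change membership in `W_𝔪` (no archimedean condition).
[cite: Shimura1998, §18.6 proof, p. 128] -/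
theorem infiniteIdeles_mul_mem_rayUnitIdeles_iff (y : (InfiniteAdeleRing K)ˣ) (e : ideleGroup K) :
    infiniteIdeles K y * e ∈ rayUnitIdeles K 𝔪 ↔ e ∈ rayUnitIdeles K 𝔪 := by
  rw [rayUnitIdeles_eq_comap, Subgroup.mem_comap, Subgroup.mem_comap, map_mul,
    finitePart_infiniteIdeles', one_mul]

/-- **With `e_∞ = 1`** (`K` totally complex: `[·, K]` kills `K_∞ˣ`): every `σ ∈ Gal(K̄/K(𝔪))` is
`[e, K]` on `K^ab` for some `e ∈ W_𝔪` with trivial infinite part.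
[cite: Shimura1998, §18.6 proof, p. 128] [cite: NeukirchANT1999, Ch. VI §6 (6.1)] -/
theorem exists_mem_rayUnitIdeles_infPart_eq_one_of_mem_ker [IsTotallyComplex K]
    {σ : absoluteGaloisGroup K} (hσ : σ ∈ (absRestrictNormalHom (rayClassField K 𝔪)).ker) :
    ∃ e ∈ rayUnitIdeles K 𝔪, HeckeCharacter.infPart K e = 1 ∧ absGaloisAbProj K σ = ideleArtinMap K e := by
  obtain ⟨e, he, hs⟩ := exists_mem_rayUnitIdeles_of_mem_ker hσ
  refine ⟨infiniteIdeles K (HeckeCharacter.infPart K e)⁻¹ * e, (infiniteIdeles_mul_mem_rayUnitIdeles_iff _ e).mpr he,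
    ?_, ?_⟩
  · rw [map_mul, HeckeCharacter.infPart_infiniteIdeles, inv_mul_cancel]
  · rw [map_mul, ideleArtinMap_infiniteIdeles, one_mul, hs]

/-- Conversely, `[e, K]` with `e ∈ W_𝔪` fixes `K(𝔪)`. [cite: NeukirchANT1999, Ch. VI §7 Thm. (7.1)] -/
theorem mem_ker_of_mem_rayUnitIdeles {σ : absoluteGaloisGroup K} {e : ideleGroup K}
    (he : e ∈ rayUnitIdeles K 𝔪) (hs : absGaloisAbProj K σ = ideleArtinMap K e) :
    σ ∈ (absRestrictNormalHom (rayClassField K 𝔪)).ker := by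
  rw [MonoidHom.mem_ker, ← abRestrict_absGaloisAbProj, hs]
  exact (abRestrict_ideleArtinMap_rayClassField_eq_one_iff e).mpr (Subgroup.mem_sup_right he)

/-! ### §2. The `v`-component of `e` is the ray adic character `κσ` -/

/-- **The `v`-component of `e` is a `v`-adic Artin value of `σ`** (every `v`, every level `n`):
`e·⟨e_v⟩_v⁻¹ ∈ W_{𝔪vⁿ}` acts trivially on `K(𝔪vⁿ)`, so `σ|_{K(𝔪vⁿ)} = [e, K]|… = [⟨e_v⟩_v, K]|…`.
[cite: Shimura1998, §18.6 proof, p. 128] [cite: deShalit1987, II.1.7 (p. 41)] -/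
theorem isAdicArtinValue_rayComponent (h𝔪 : 𝔪 ≠ ⊥) {σ : absoluteGaloisGroup K} {e : ideleGroup K}
    (he : e ∈ rayUnitIdeles K 𝔪) (hs : absGaloisAbProj K σ = ideleArtinMap K e) :
    IsAdicArtinValue 𝔪 v σ (rayComponent v e he) := by
  intro n
  set c := localUnits v (Units.map ((v.adicCompletionIntegers K).subtype : _ →* _)
    (rayComponent v e he)) with hc_def
  have he' : e * c⁻¹ ∈ rayUnitIdeles K (𝔪 * v.asIdeal ^ n) :=
    mul_inv_localUnits_rayComponent_mem_rayUnitIdeles_mul_pow h𝔪 n e he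
  have h2 : abRestrict (rayClassField K (𝔪 * v.asIdeal ^ n)) (ideleArtinMap K (e * c⁻¹)) = 1 :=
    (abRestrict_ideleArtinMap_rayClassField_eq_one_iff _).mpr (Subgroup.mem_sup_right he')
  rw [← abRestrict_absGaloisAbProj, hs,
    show e = e * c⁻¹ * c by rw [inv_mul_cancel_right], map_mul, map_mul, h2, one_mul]

variable [IsTotallyComplex K]

/-- ★ **`κσ = e_v`**: for `K` totally complex, `𝔪 ≠ 0`, `v ∤ 𝔪`, `w_𝔪 = 1`, `σ ∈ Gal(K̄/K(𝔪))` and ANY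
`e ∈ W_𝔪` with `σ|_{K^ab} = [e, K]`, the ray adic character is the `v`-component of `e`
(uniqueness of adic Artin values). [cite: deShalit1987, I.3.3 (9) (p. 18), II.1.7 (p. 41)]
[cite: Shimura1998, §18.6 proof, p. 128] -/
theorem rayAdicCharacter_eq_rayComponent (h𝔪 : 𝔪 ≠ ⊥) (hv : ¬ 𝔪 ≤ v.asIdeal)
    (hw : ∀ u : (𝓞 K)ˣ, (u : 𝓞 K) - 1 ∈ 𝔪 → u = 1)
    (σ : ↥(absRestrictNormalHom (rayClassField K 𝔪)).ker) {e : ideleGroup K}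
    (he : e ∈ rayUnitIdeles K 𝔪) (hs : absGaloisAbProj K (σ : absoluteGaloisGroup K) = ideleArtinMap K e) :
    rayAdicCharacter h𝔪 hv hw σ = rayComponent v e he :=
  rayAdicCharacter_eq_of_isAdicArtinValue h𝔪 hv hw (isAdicArtinValue_rayComponent h𝔪 he hs)

/-- ★ **`e_v = κσ` in `K_v`**: the `v`-coordinate of the idele `e` is the ray adic character, read in
`K_v` — the form consumed by the idelic avatar (`PlaceEmb.coe_eval`, `coe_algPart_localUnits`).
[cite: deShalit1987, II.4.13 (p. 69)] -/
theorem adele_snd_eq_rayAdicCharacter (h𝔪 : 𝔪 ≠ ⊥) (hv : ¬ 𝔪 ≤ v.asIdeal)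
    (hw : ∀ u : (𝓞 K)ˣ, (u : 𝓞 K) - 1 ∈ 𝔪 → u = 1)
    (σ : ↥(absRestrictNormalHom (rayClassField K 𝔪)).ker) {e : ideleGroup K}
    (he : e ∈ rayUnitIdeles K 𝔪) (hs : absGaloisAbProj K (σ : absoluteGaloisGroup K) = ideleArtinMap K e) :
    (e : AdeleRing (𝓞 K) K).2 v =
      (((rayAdicCharacter h𝔪 hv hw σ : (v.adicCompletionIntegers K)ˣ) : v.adicCompletionIntegers K) :
        v.adicCompletion K) := by
  rw [rayAdicCharacter_eq_rayComponent h𝔪 hv hw σ he hs, coe_rayComponent]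

/-- ★ **The two statements assembled**: for `K` totally complex, `𝔪 ≠ 0` and `σ ∈ Gal(K̄/K(𝔪))` there
is `e ∈ W_𝔪` with `e_∞ = 1`, `σ|_{K^ab} = [e, K]`, and `e_v = κ_v σ` at EVERY `v ∤ 𝔪` (for each
admissible `w_𝔪 = 1` datum). [cite: deShalit1987, II.4.13 (p. 69)] [cite: Shimura1998, §18.6 proof, p. 128] -/
theorem exists_rayKernelIdele (h𝔪 : 𝔪 ≠ ⊥) (hw : ∀ u : (𝓞 K)ˣ, (u : 𝓞 K) - 1 ∈ 𝔪 → u = 1)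
    (σ : ↥(absRestrictNormalHom (rayClassField K 𝔪)).ker) :
    ∃ e ∈ rayUnitIdeles K 𝔪, HeckeCharacter.infPart K e = 1 ∧
      absGaloisAbProj K (σ : absoluteGaloisGroup K) = ideleArtinMap K e ∧
      ∀ (w : HeightOneSpectrum (𝓞 K)) (hvw : ¬ 𝔪 ≤ w.asIdeal),
        (e : AdeleRing (𝓞 K) K).2 w =
          (((rayAdicCharacter h𝔪 hvw hw σ : (w.adicCompletionIntegers K)ˣ) :
            w.adicCompletionIntegers K) : w.adicCompletion K) := by
  obtain ⟨e, he, hinf, hs⟩ := exists_mem_rayUnitIdeles_infPart_eq_one_of_mem_ker σ.2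
  exact ⟨e, he, hinf, hs, fun w hvw ↦ adele_snd_eq_rayAdicCharacter h𝔪 hvw hw σ he hs⟩

end Literature.NumberTheory.NumberFields

end
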